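import Summits.Ventures.PercRepro.S1CellCaps5

/-!
# PercRepro — THE TWO BOUNDS OF THE CELL FORM, EXPOSED (p2, gen 21; SUBCLAIM-S1 §6.5)

`rls_of_cellOK14` proves `7560·#U ≤ UB` and `Ysum ≤ 7560·#Y + R34B` and then combines them with the cell's `Φ(p, 4)`.
The two bounds are stated here on their own (`cellUB`, `cellR34`, `cellYsum` are the three numbers of `cellOK14`,
and `cell_bounds` is that proof with the final chain cut off), so that a cell can be combined with ANY weight and
ANY additive `Y`-side credit — the coloop ladder of S1Ladder needs `Φ(p + c, 4)·#U_N ≤ #Y_N + X`.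

* `cellUB`, `cellR34`, `cellYsum` — the numbers; `cellOK14_eq` — `cellOK14` in their terms;
* **`cell_bounds`** — `7560·#U(p, 4) ≤ cellUB` and `cellYsum ≤ 7560·#Y(p, 4) + cellR34` on the capped core.
Axioms: standard.
-/

open scoped Matroid

namespace PercRepro

namespace S1

open Set

variable {α : Type}

/-- The `U`-bound of the cell form, `7560·U⁺` (the `U` of `cellOK14`). -/
def cellUB (p d P S S5 : ℕ) : ℕ :=
  let n := p + d
  let m := min (5 * d) n
  let s3 := min (min (d * (d + 1) / 2) ((d * d + 6 - 3 * d) / 2)) P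
  let s4 := min (min (min (CoreRegimes.chooseF (d + 3) 4) (d * (d + 1) * (d + 2) / 3)) (fourCircuitBound d)) S
  let s5 := min (CoreRegimes.chooseF (d + 4) 5) S5
  let piAll := s3 * CoreRegimes.chooseF (n - 3) 2 + s4 * (n - 4) + s5
  let piS0 := s3 * CoreRegimes.chooseF (m - 3) 2 + s4 * (m - 4) + s5
  let sigs := ∑ j ∈ Finset.range (d - 5 + 1), Nat.choose 2 j
  let sig := ∑ j ∈ Finset.range (d - 5 + 1), Nat.choose 5 j
  let c3 := RSK d * CoreRegimes.chooseF (n - 3) 2 + (RBab d - RSK d) * CoreRegimes.chooseF (m - 3) 2 - 7560 * (n - 3)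
  let c4 := RSK d * (n - 4) + (RBab d - RSK d) * (m - 4) - 7560
  let c5 := RSK d + (RBab d - RSK d)
  min (7560 * CoreRegimes.chooseF n 4 + c3 * s3 + c4 * s4 + c5 * s5 + Kab d)
    (7560 * (CoreRegimes.chooseF n 4 + sigs * piAll + (sig - sigs) * piS0))

/-- The `R₃ + R₄` correction of the cell form (the `R3 + R4` of `cellOK14`). -/
def cellR34 (p d P S S5 : ℕ) : ℕ :=
  let n := p + d
  let m := min (5 * d) n
  let s3 := min (min (d * (d + 1) / 2) ((d * d + 6 - 3 * d) / 2)) P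
  let s4 := min (min (min (CoreRegimes.chooseF (d + 3) 4) (d * (d + 1) * (d + 2) / 3)) (fourCircuitBound d)) S
  let s5 := min (CoreRegimes.chooseF (d + 4) 5) S5
  let piAll := s3 * CoreRegimes.chooseF (n - 3) 2 + s4 * (n - 4) + s5
  let piS0 := s3 * CoreRegimes.chooseF (m - 3) 2 + s4 * (m - 4) + s5
  10584 * (s3 * (n - 3) + s4) + (RSK 10 * piAll + (RBK 10 - RSK 10) * piS0)

/-- The `Y`-sum of the cell form, `7560·Σ_{5≤j<p} C(n, j)`. -/
def cellYsum (p d : ℕ) : ℕ := 7560 * ∑ j ∈ Finset.Ico 5 p, CoreRegimes.chooseF (p + d) j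

/-- `cellOK14` in the three numbers. -/
theorem cellOK14_eq (p d P S S5 : ℕ) : cellOK14 p d P S S5 =
    decide (cellR34 p d P S S5 ≤ cellYsum p d ∧
      (2 ^ (p + 4) - 2 * ∑ u ∈ Finset.range 5, CoreRegimes.chooseF (p + 4) u) * cellUB p d P S S5 +
        CoreRegimes.chooseF (p + 4) 4 * cellR34 p d P S S5 ≤ CoreRegimes.chooseF (p + 4) 4 * cellYsum p d) := rfl

/-- **THE TWO BOUNDS OF THE CELL FORM**: on the `e`-free core of rank `p ≥ 5` and corank `d ≥ 4` with `s₃ ≤ P`,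
`s₄ ≤ S`, `s₅ ≤ S5`: `7560·#U(p, 4) ≤ cellUB` and `cellYsum ≤ 7560·#Y(p, 4) + cellR34`. -/
theorem cell_bounds (M : Matroid α) [M.Finite] (p d P S S5 : ℕ) (hd4 : 4 ≤ d) (hR : M.eRank = (p : ℕ∞))
    (hn : M.E.ncard = p + d)
    (hfree : ∀ e ∈ M.E, ∃ A ⊆ M.E \ {e}, e ∉ M.closure A ∧ e ∉ M.closure ((M.E \ {e}) \ A))
    (hP : {C : Set α | M.IsCircuit C ∧ C.ncard = 3}.ncard ≤ P) (hS : {C : Set α | M.IsCircuit C ∧ C.ncard = 4}.ncard ≤ S)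
    (hS5 : {C : Set α | M.IsCircuit C ∧ C.ncard = 5}.ncard ≤ S5)
    (hp : 5 ≤ p) :
    7560 * Matroid.topCount M p 4 ≤ cellUB p d P S S5 ∧
      cellYsum p d ≤ 7560 * Matroid.midCount M p 4 + cellR34 p d P S S5 := by
  unfold cellUB cellR34 cellYsum
  simp only [CoreRegimes.chooseF_eq]
  classical
  -- the core facts
  have hL : ∀ e ∈ M.E, ¬ M.IsLoop e := ThmN.not_isLoop_of_free M hfree
  have hs : ∀ e ∈ M.E, ∀ f ∈ M.E, e ≠ f → M.eRk {e, f} = 2 := by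
    intro e he f hf hef
    have h2 : (2 : ℕ∞) ≤ M.eRk {e, f} :=
      ThmN.two_le_eRk_of_two_le_ncard_of_free M hfree (pair_subset he hf) (by rw [ncard_pair hef])
    have h3 : M.eRk {e, f} ≤ 2 := by
      have := M.eRk_le_encard {e, f}
      rwa [encard_pair hef] at this
    exact le_antisymm h3 h2
  have hcirc : ∀ C, M.IsCircuit C → 3 ≤ C.encard := ThmN.three_le_encard_of_circuit M hL hs
  have hline : ∀ L ⊆ M.E, M.eRk L ≤ 2 → L.ncard ≤ 3 := by
    intro L hL' hr
    have := ThmN.ncard_add_one_le_two_pow_of_eRk_le M hL hfree 2 L hL' hr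
    omega
  have hplane : ∀ P ⊆ M.E, M.eRk P ≤ 3 → P.ncard ≤ 6 := fun P hP hr =>
    ThmN.ncard_le_six_of_eRk_le_three_of_free M hfree hP hr
  have hten : ∀ X ⊆ M.E, M.eRk X ≤ 4 → X.ncard ≤ 10 := fun X hX hr =>
    ThmN.ncard_le_ten_of_eRk_le_four_of_free M hfree hX hr
  have hd : M.E.encard = M.eRank + d := by
    rw [hR, ← M.ground_finite.cast_ncard_eq, hn]
    push_cast
    ring
  -- the counts
  set s3 := {C : Set α | M.IsCircuit C ∧ C.ncard = 3}.ncard with hs3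
  set s4 := {C : Set α | M.IsCircuit C ∧ C.ncard = 4}.ncard with hs4
  set s5 := {C : Set α | M.IsCircuit C ∧ C.ncard = 5}.ncard with hs5
  have hb3 : s3 ≤ min (min (d * (d + 1) / 2) ((d * d + 6 - 3 * d) / 2)) P := by
    have h := two_mul_ncard_triangles_le M (fun L hL hr => hline L hL hr.le) hd
    have h' : 2 * s3 ≤ d * (d + 1) := h
    have h2 := two_mul_ncard_triangles_add_three_mul_le_of_four_le M
      (fun L hL hr => hline L hL hr.le) hplane hd4 hd
    have h2' : 2 * s3 + 3 * d ≤ d * d + 6 := h2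
    refine le_min (le_min ?_ ?_) hP
    · rw [Nat.le_div_iff_mul_le (by norm_num)]; omega
    · rw [Nat.le_div_iff_mul_le (by norm_num)]; omega
  have hb4 : s4 ≤ min (min (min ((d + 3).choose 4) (d * (d + 1) * (d + 2) / 3)) (fourCircuitBound d)) S := by
    refine le_min (le_min (le_min (ncard_circuits_four_le M hd) ?_) (ncard_fourCircuits_le_fourCircuitBound M hfree hd)) hS
    have h := three_mul_ncard_four_circuits_le M hline hplane hd
    have h' : 3 * s4 ≤ d * (d + 1) * (d + 2) := h
    rw [Nat.le_div_iff_mul_le (by norm_num)]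
    omega
  have hb5 : s5 ≤ min ((d + 4).choose 5) S5 := le_min (ncard_circuits_five_le M hd) hS5
  have hU1 := topCount_le_ncard_eRk_eq_four_ncard_le M hR hd
  -- the per-flat `U`-bound with the flat profile: `d ≤ 6` / `d = 7` / `d ≥ 8`
  have hU2 : 7560 * {B : Set α | B ⊆ M.E ∧ M.eRk B = 4 ∧ B.ncard ≤ d}.ncard +
      7560 * (s3 * (M.E.ncard - 3) + s4) ≤
      7560 * M.E.ncard.choose 4 +
      RSK d * (s3 * (M.E.ncard - 3).choose 2 + s4 * (M.E.ncard - 4) + s5) +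
      (RBab d - RSK d) * (s3 * (min (5 * d) M.E.ncard - 3).choose 2 + s4 * (min (5 * d) M.E.ncard - 4) + s5) +
      Kab d := by
    rcases Nat.lt_or_ge d 7 with h6 | h7
    · rw [RBab_of_le_six (by omega), Kab_of_le_seven (by omega)]
      exact ncard_eRk_eq_four_ncard_le_le_AB6 M hcirc hline hplane hten hd (by omega)
    rcases Nat.lt_or_ge d 8 with h7' | h8
    · rw [RBab_of_eq_seven (by omega), Kab_of_le_seven (by omega)]
      exact ncard_eRk_eq_four_ncard_le_le_AB7 M hcirc hline hplane hten hd (by omega)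
    · rw [RBab_of_eight_le h8, Kab_of_eight_le h8, Nat.add_zero]
      exact ncard_eRk_eq_four_ncard_le_le_L1 M hcirc hline hplane hten hd
  have hU3 := ncard_eRk_eq_ncard_le_le_split_joint' M 4 10 6 (by norm_num) hcirc hten
    (fun X hX hr => hplane X hX (by simpa using hr)) hd
  rw [sum_Icc_three_five' (fun k => {C : Set α | M.IsCircuit C ∧ C.ncard = k}.ncard),
    sum_Icc_three_five' (fun k => {C : Set α | M.IsCircuit C ∧ C.ncard = k}.ncard)] at hU3
  have hY := midCount_ge_K7 M hcirc hline hplane hten hd p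
  rw [hn] at hU2 hU3 hY
  -- the bounds dominate the counts
  set m := min (5 * d) (p + d) with hm
  set s3B := min (min (d * (d + 1) / 2) ((d * d + 6 - 3 * d) / 2)) P with hs3B
  set s4B := min (min (min ((d + 3).choose 4) (d * (d + 1) * (d + 2) / 3)) (fourCircuitBound d)) S with hs4B
  set s5B := min ((d + 4).choose 5) S5 with hs5B
  set piAll := s3 * (p + d - 3).choose 2 + s4 * (p + d - 4) + s5 with hpiAll
  set piS0 := s3 * (m - 3).choose 2 + s4 * (m - 4) + s5 with hpiS0
  set piAllB := s3B * (p + d - 3).choose 2 + s4B * (p + d - 4) + s5B with hpiAllB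
  set piS0B := s3B * (m - 3).choose 2 + s4B * (m - 4) + s5B with hpiS0B
  have hpiAll_le : piAll ≤ piAllB := by
    rw [hpiAll, hpiAllB]; gcongr
  have hpiS0_le : piS0 ≤ piS0B := by
    rw [hpiS0, hpiS0B]; gcongr
  have hR3_le : 10584 * (s3 * (p + d - 3) + s4) ≤ 10584 * (s3B * (p + d - 3) + s4B) := by
    gcongr
  set R34B := 10584 * (s3B * (p + d - 3) + s4B) + (RSK 10 * piAllB + (RBK 10 - RSK 10) * piS0B) with hR34B
  set sigs := ∑ j ∈ Finset.range (d - 5 + 1), Nat.choose 2 j with hsigs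
  set sig := ∑ j ∈ Finset.range (d - 5 + 1), Nat.choose 5 j with hsig
  -- the regrouped per-flat bound
  set A3 := RSK d * (p + d - 3).choose 2 + (RBab d - RSK d) * (m - 3).choose 2 with hA3
  set A4 := RSK d * (p + d - 4) + (RBab d - RSK d) * (m - 4) with hA4
  set c5 := RSK d + (RBab d - RSK d) with hc5
  set c3 := A3 - 7560 * (p + d - 3) with hc3
  set c4 := A4 - 7560 with hc4
  have hRSK : 7560 ≤ RSK d := Nat.le_add_right _ _
  have hA3ge : 7560 * (p + d - 3) ≤ A3 := by
    have h1 : p + d - 3 ≤ (p + d - 3).choose 2 := le_choose_two _ (by omega)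
    calc 7560 * (p + d - 3) ≤ RSK d * (p + d - 3).choose 2 := Nat.mul_le_mul hRSK h1
      _ ≤ A3 := Nat.le_add_right _ _
  have hA4ge : 7560 ≤ A4 := by
    calc 7560 = 7560 * 1 := by ring
      _ ≤ RSK d * (p + d - 4) := Nat.mul_le_mul hRSK (by omega)
      _ ≤ A4 := Nat.le_add_right _ _
  have hA3eq : A3 = c3 + 7560 * (p + d - 3) := (Nat.sub_add_cancel hA3ge).symm
  have hA4eq : A4 = c4 + 7560 := (Nat.sub_add_cancel hA4ge).symm
  have hident : RSK d * piAll + (RBab d - RSK d) * piS0 = A3 * s3 + A4 * s4 + c5 * s5 := by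
    rw [hpiAll, hpiS0, hA3, hA4, hc5]; ring
  set UB := min (7560 * (p + d).choose 4 + c3 * s3B + c4 * s4B + c5 * s5B + Kab d)
    (7560 * ((p + d).choose 4 + sigs * piAllB + (sig - sigs) * piS0B)) with hUB
  set Ysum := 7560 * ∑ j ∈ Finset.Ico 5 p, (p + d).choose j with hYsum
  set phiNum := 2 ^ (p + 4) - 2 * ∑ u ∈ Finset.range 5, (p + 4).choose u with hphiNum
  set phiDen := (p + 4).choose 4 with hphiDen
  -- `7560·#U ≤ UB` (both counts)
  have hUB : 7560 * Matroid.topCount M p 4 ≤ UB := by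
    have hU0 : 7560 * Matroid.topCount M p 4 ≤
        7560 * {B : Set α | B ⊆ M.E ∧ M.eRk B = 4 ∧ B.ncard ≤ d}.ncard := Nat.mul_le_mul_left _ hU1
    refine le_min ?_ ?_
    · -- the flat-profile branch with L1
      have hL : 7560 * {B : Set α | B ⊆ M.E ∧ M.eRk B = 4 ∧ B.ncard ≤ d}.ncard +
          7560 * (s3 * (p + d - 3) + s4) ≤
          7560 * (p + d).choose 4 + (A3 * s3 + A4 * s4 + c5 * s5) + Kab d := by
        rw [← hident]
        have e : 7560 * (p + d).choose 4 + (RSK d * piAll + (RBab d - RSK d) * piS0) + Kab d =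
            7560 * (p + d).choose 4 + RSK d * piAll + (RBab d - RSK d) * piS0 + Kab d := by ring
        rw [e]
        exact hU2
      rw [hA3eq, hA4eq] at hL
      have hL' : 7560 * {B : Set α | B ⊆ M.E ∧ M.eRk B = 4 ∧ B.ncard ≤ d}.ncard ≤
          7560 * (p + d).choose 4 + (c3 * s3 + c4 * s4 + c5 * s5) + Kab d := by
        have e : 7560 * (p + d).choose 4 + ((c3 + 7560 * (p + d - 3)) * s3 + (c4 + 7560) * s4 + c5 * s5) + Kab d =
            7560 * (p + d).choose 4 + (c3 * s3 + c4 * s4 + c5 * s5) + Kab d + 7560 * (s3 * (p + d - 3) + s4) := by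
          ring
        rw [e] at hL
        omega
      calc 7560 * Matroid.topCount M p 4
          ≤ 7560 * {B : Set α | B ⊆ M.E ∧ M.eRk B = 4 ∧ B.ncard ≤ d}.ncard := hU0
        _ ≤ 7560 * (p + d).choose 4 + (c3 * s3 + c4 * s4 + c5 * s5) + Kab d := hL'
        _ ≤ 7560 * (p + d).choose 4 + c3 * s3B + c4 * s4B + c5 * s5B + Kab d := by
            have h3 := Nat.mul_le_mul_left c3 hb3
            have h4 := Nat.mul_le_mul_left c4 hb4
            have h5 := Nat.mul_le_mul_left c5 hb5
            omega
    · calc 7560 * Matroid.topCount M p 4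
          ≤ 7560 * {B : Set α | B ⊆ M.E ∧ M.eRk B = 4 ∧ B.ncard ≤ d}.ncard := hU0
        _ ≤ 7560 * ((p + d).choose 4 + sigs * piAll + (sig - sigs) * piS0) := Nat.mul_le_mul_left _ hU3
        _ ≤ 7560 * ((p + d).choose 4 + sigs * piAllB + (sig - sigs) * piS0B) := by gcongr
  -- `Ysum ≤ 7560·#Y + R34B`
  have hYB : Ysum ≤ 7560 * Matroid.midCount M p 4 + R34B := by
    calc Ysum ≤ 7560 * Matroid.midCount M p 4 + 10584 * (s3 * (p + d - 3) + s4) +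
          (RSK 10 * piAll + (RBK 10 - RSK 10) * piS0) := hY
      _ ≤ 7560 * Matroid.midCount M p 4 + R34B := by
          rw [hR34B]
          have : RSK 10 * piAll + (RBK 10 - RSK 10) * piS0 ≤ RSK 10 * piAllB + (RBK 10 - RSK 10) * piS0B := by
            gcongr
          omega
  exact ⟨hUB, hYB⟩

end S1

end PercRepro
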